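import Summits.QuantumFields.YangMills.Theorems.UnitScaleTiltFluctuationComparisonRegPrGlobalSlackCanonicalPolymersLambdaStepV4
import Summits.QuantumFields.YangMills.Theorems.UnitScaleTiltFluctuationComparisonRegPrGlobalSlackTwoProfile
import Summits.QuantumFields.YangMills.Theorems.UnitScaleTiltFluctuationComparisonRegPrGlobalSlackCanonicalPolymersNewTermCollar
import HarnessLib

/-!
# `UnitScaleTiltFluctuationComparisonRegPrGlobalSlackCanonicalPolymersNewTermCollarV4` — THE v4 TWIN (★★OWNER RULING g26-№14 (F-2b); P22b polymer-step branch, width seat ym-ust-20520-w2 g4; skeleton v5kD; record-free decls imported from `…GlobalSlackCanonicalPolymersNewTermCollar`) of `…GlobalSlackCanonicalPolymersNewTermCollar` — THE WHOLE NEWBORN TWO-RUN ROW OF (i*)χ/3⁗χ AT THE COLLAR PROFILE `p₀ + r₀` FROM KING'S TWO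
# NUMBER COMPARISONS (Ψ- AND Λ-KERNELS) AND THE CONFIGURATION CAUCHY ROW (crux `FluctuationComparisonRegPrIntL`, stmt-QuantumFields-20520, skeleton v5kC; lane B seat
# ym-ust-19935-r1 g5, completing ym-ust-20520-w2 g0's newborn-row programme in the collar currency)

WHY.  ★r1 g5's `…JetStep` (p591487) and `…LambdaStep` (p591952) discharge the two halves of the newborn row from displayed hypothesis schemas: the step-chart jets at any window with
the record-profile weight `θ_{b₀,p₀}²` and rate `a(1−t)`, the Λ-family at the collar window/profile `p₀ + r₀` with weight `θ_{b₀,p₀+r₀}²` and rate `a`.  w2 g0's combination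
`newTermSlackOnRows_of_jetStep_lambda` (p584833) is pinned at the record's profile.  This file aligns the currencies and composes AT THE COLLAR PROFILE — the currency the crux reads through
`InteriorExcision.regPrIntL_of_recChi_slackOnChi_higherProfile_allL` (p589812):

* §1 monotonicity of the two rows: `jetStepSlackOnRows_mono_w` (a larger rate weight), `lambdaTermSlackOnRows_mono_a` (a smaller rate exponent);
* §2 **`newTermSlackOnRows_of_jetStep_lambda_collar`** — w2's combination restated at window/profile `(𝔠.b₀, 𝔠.p₀ + 𝔠.r₀)`: `JetStepSlackOnRows ∧ LambdaTermSlackOnRows ⟹ NewTermSlackOnRows` with the step far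
  terms' `θ_{b₀,p₀}(n)⁷`-slack (`abs_farStepRows_sub_le`) read at the collar profile (`GlobalSlackOn.θBal_mono_p`);
* §3 **`newTermSlackOnRows_collar_of_k1a_cfgCauchy`** : `K1aStepΨRows q κ₁ a C_Ψ → K1aStepΛRows q κ₁ a C_Λ → CfgCauchyStepOnRows S q 𝔠.b₀ (𝔠.p₀+𝔠.r₀) a C_B →
  NewTermSlackOnRows S q 𝔠.b₀ (𝔠.p₀+𝔠.r₀) κ₁ (θ_{𝔠.b₀,𝔠.p₀+𝔠.r₀}²) (a(1−t)) 7 C` (explicit `C`; `0 < t ≤ 1`, `κ₁ ≤ 𝔠.κ`, `√γ ≤ e^{1−(p₀+r₀)}`, configuration window `cB·r(g)g p(g) ≤ 1`).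
UPSHOT, BY NAME: the NEWBORN side of 3⁗χ/(i*)χ needs exactly THREE displayed two-run rows — `K1aStepΨRows`, `K1aStepΛRows` ([King1986] Prop. 3.6 for the two chart families; unprinted for
non-abelian d = 3) and `CfgCauchyStepOnRows` at the collar window (the 19200-side loop-variable comparison, Prop. 3.9) — and nothing else; the OLD side is `OldTermSlackOnRows` ((M1)).  HONEST
FRAMING: a composition of reductions over hypothesis schemas; nothing of [Balaban1985UV3]/[King1986] is asserted; no numerics; registry untouched (`--supports stmt-QuantumFields-20520`).
YM₃ on the torus is a rung of the ladder, not the Clay problem; nothing here is a claim about the crux or the gap.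

References: C. King, CMP 102 (1986) 649–677 [King1986] (Prop. 3.6 (3.55)–(3.56) p.662, Prop. 3.8 (3.71) p.664, Prop. 3.9 (3.73)–(3.75) p.665, Thm 3.4 (3.9) p.656); T. Bałaban,
CMP 102 (1985) 255–275 [Balaban1985UV3] ((7) p.257, (28) p.263, (33)–(34) p.264, (57) p.270, (59)–(63) pp.270–272).
-/

set_option autoImplicit false

noncomputable section

namespace Summit.QuantumFields.YangMills.Theorems.GlobalSlackCanonicalPolymers

open scoped BigOperators
open Finset
open Literature.MathematicalPhysics.QuantumFieldTheory.Balaban1983to89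
open Literature.MathematicalPhysics.QuantumFieldTheory.Balaban1983to89.T3ContinuumYM3Torus
open Literature.MathematicalPhysics.QuantumFieldTheory.Balaban1983to89.T3UnitScaleTilt (θBal)
open Literature.MathematicalPhysics.QuantumFieldTheory.Balaban1983to89.T3LevelShift (fieldShift)
open Literature.MathematicalPhysics.QuantumFieldTheory.Balaban1983to89.T3Thresholds (θBal_succ_le)
open Literature.MathematicalPhysics.QuantumFieldTheory.Balaban1983to89.T3AlphaInputsAC
open Literature.MathematicalPhysics.QuantumFieldTheory.Balaban1983to89.T3AlphaPolymerSocket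
open Literature.MathematicalPhysics.QuantumFieldTheory.Balaban1983to89.T3AlphaInputsACTwoRunLevel
open Literature.MathematicalPhysics.QuantumFieldTheory.Balaban1983to89.TreeLengthTorus (tsys TPt)
open Literature.MathematicalPhysics.QuantumFieldTheory.Balaban1985CMP102
open Literature.MathematicalPhysics.QuantumFieldTheory.Balaban1985CMP102.Setting
open Literature.MathematicalPhysics.QuantumFieldTheory.Balaban1985CMP102.Binders (ChartAnalyticityAsCited)
open Summit.QuantumFields.Balaban3D.Carriers
open Summit.QuantumFields.Balaban3D.Proofs.Primitives
open Summit.QuantumFields.Balaban3D.Proofs.GroupModelLieC (lieC)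
open Summit.QuantumFields.Balaban3D.Proofs.Representation33 (jet26)
open Summit.QuantumFields.Balaban3D.Proofs.NewbornJet (rFun_pow)
open Summit.QuantumFields.Balaban3D.Proofs.ScalesArithmetic (gk_pos gk_le_one)
open Summit.QuantumFields.YangMills.Theorems
open Summit.QuantumFields.YangMills.Theorems.GlobalSlackKernelMatching
open Summit.QuantumFields.YangMills.Theorems.GlobalSlackKernelMatchingOn (WinPred)

variable {F : T3Family} {𝔠 : AlphaConsts F.L (suGroupModel 2).N} {γ : ℝ} {hγ : 0 < γ} {hγ1 : γ ≤ (min 𝔠.gamma0 1) ^ 2}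

open Summit.QuantumFields.YangMills.Theorems.GlobalSlackKernelRescale (logPowConst logPowConst_pos)

/-! ## §1 Monotonicity of the two newborn rows in the rate weight and the rate exponent -/

/-- A larger rate weight is a weaker step-jet row (`0 ≤ C`). [folklore] -/
theorem jetStepSlackOnRows_mono_w (S : WinPred F) (q : ∀ K, AlphaInputsT3AC.PkgCoreRows F 𝔠 γ hγ hγ1 K) {b₀ p₀ κ₁ a C : ℝ} {w w' : ℕ → ℝ}
    (hC : 0 ≤ C) (hww : ∀ n, w n ≤ w' n) (h : JetStepSlackOnRows S q b₀ p₀ κ₁ w a C) : JetStepSlackOnRows S q b₀ p₀ κ₁ w' a C := by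
  obtain ⟨c, hc⟩ := h
  refine ⟨c, fun K n hn k hk V hV hS hS' X hX => (hc K n hn k hk V hV hS hS' X hX).trans ?_⟩
  have hx : 0 ≤ (((F.L : ℝ) ^ (1 + k))⁻¹) ^ a := Real.rpow_nonneg (by positivity) _
  exact mul_le_mul_of_nonneg_left (mul_le_mul_of_nonneg_right (hww n) hx) (mul_nonneg hC (Real.exp_pos _).le)

/-- A smaller rate exponent is a weaker Λ-row (`a' ≤ a`, `0 ≤ C`, `0 ≤ w`). [folklore] -/
theorem lambdaTermSlackOnRows_mono_a (S : WinPred F) (q : ∀ K, AlphaInputsT3AC.PkgCoreRows F 𝔠 γ hγ hγ1 K) {b₀ p₀ κ₁ a a' C : ℝ} {w : ℕ → ℝ} {σ : ℕ}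
    (hC : 0 ≤ C) (hw : ∀ n, 0 ≤ w n) (haa : a' ≤ a) (h : LambdaTermSlackOnRows S q b₀ p₀ κ₁ w a σ C) : LambdaTermSlackOnRows S q b₀ p₀ κ₁ w a' σ C := by
  obtain ⟨c, hc⟩ := h
  refine ⟨c, fun K n hn k hk V hV hS hS' X hX => (hc K n hn k hk V hV hS hS' X hX).trans ?_⟩
  have hL1 : (1 : ℝ) ≤ (F.L : ℝ) := by exact_mod_cast F.hL.2.le
  have hx0 : 0 < ((F.L : ℝ) ^ (1 + k))⁻¹ := by positivity
  have hx1 : ((F.L : ℝ) ^ (1 + k))⁻¹ ≤ 1 := inv_le_one_of_one_le₀ (one_le_pow₀ hL1)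
  have hρ : (((F.L : ℝ) ^ (1 + k))⁻¹) ^ a ≤ (((F.L : ℝ) ^ (1 + k))⁻¹) ^ a' := Real.rpow_le_rpow_of_exponent_ge hx0 hx1 haa
  exact mul_le_mul_of_nonneg_left (add_le_add (mul_le_mul_of_nonneg_left hρ (hw n)) le_rfl) (mul_nonneg hC (Real.exp_pos _).le)

/-! ## §2 w2's combination of the two newborn rows, at the collar profile -/

-- (record-free `three_terms_collar`: imported from the v3 module, not restated)

/-- **THE NEWBORN-TERM ROW AT THE COLLAR PROFILE FROM THE STEP-JET ROW AND THE Λ ROW THERE** (window and slack at `(𝔠.b₀, 𝔠.p₀ + 𝔠.r₀)`, `σ = 7`; `κ₁ ≤ 𝔠.κ`; `√γ ≤ e^{1−p₀}`; weight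
`w ≥ 0`, `C_J ≥ 0`): `JetStepSlackOnRows ∧ LambdaTermSlackOnRows ⟹ NewTermSlackOnRows` with the third summand `2·Cfar·C25·M(7r₀,1)` = the two-run bound on the STEP far terms (w2 g0's
`abs_farStepRows_sub_le`, slack `θ_{b₀,p₀}(n)⁷ ≤ θ_{b₀,p₀+r₀}(n)⁷` by `GlobalSlackOn.θBal_mono_p`). [cite: King1986, Thm 3.4 (3.9) p.656, Prop. 3.6 (3.56) p.662; Balaban1985UV3, (33) p.264, (57) p.270, (59)-(63) pp.270-272] -/
theorem newTermSlackOnRows_of_jetStep_lambda_collar (S : WinPred F) (q : ∀ K, AlphaInputsT3AC.PkgCoreRows F 𝔠 γ hγ hγ1 K) {κ₁ a C_J C_Λ : ℝ} {w : ℕ → ℝ}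
    (hκ₁ : κ₁ ≤ 𝔠.κ) (hγe : Real.sqrt γ ≤ Real.exp (1 - 𝔠.p₀)) (hw : ∀ n, 0 ≤ w n) (hCJ : 0 ≤ C_J)
    (hJ : JetStepSlackOnRows S q 𝔠.b₀ (𝔠.p₀ + 𝔠.r₀) κ₁ w a C_J) (hΛ : LambdaTermSlackOnRows S q 𝔠.b₀ (𝔠.p₀ + 𝔠.r₀) κ₁ w a 7 C_Λ) :
    NewTermSlackOnRows S q 𝔠.b₀ (𝔠.p₀ + 𝔠.r₀) κ₁ w a 7 (C_J + C_Λ + 2 * (𝔠.Cfar * 𝔠.C25 * logPowConst (7 * 𝔠.r₀) 1)) := by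
  obtain ⟨cJ, hcJ⟩ := hJ
  obtain ⟨cΛ, hcΛ⟩ := hΛ
  have hL : 1 ≤ F.L := F.hL.2.le
  have hL0 : (0 : ℝ) < (F.L : ℝ) := by exact_mod_cast (zero_lt_one.trans F.hL.2)
  have hγ1' : γ ≤ 1 := hγ1.trans (sq_min_one_le _ 𝔠.gamma0_pos)
  have hr0 : 0 ≤ 𝔠.r₀ := le_trans zero_le_one 𝔠.one_le_r₀
  have hF : 0 ≤ 𝔠.Cfar * 𝔠.C25 * logPowConst (7 * 𝔠.r₀) 1 := by
    have := 𝔠.Cfar_nonneg; have := 𝔠.C25_nonneg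
    have := (logPowConst_pos (q := 7 * 𝔠.r₀) (c := 1) (by linarith [𝔠.one_le_r₀]) one_pos).le
    positivity
  refine ⟨fun K k X => cJ K k X + cΛ K k X, fun K n hn k hk V hV hS hS' X hX => ?_⟩
  have hkK : k + 1 ≤ K := by omega
  have hj := hcJ K n hn k hk V hV hS hS' X hX
  have hl := hcΛ K n hn k hk V hV hS hS' X hX
  have hf0 := abs_farStepRows_sub_le q hκ₁ hγe K n k hk hkK X
    (fieldShift (F.sitesPerDir_eq (m := F.m) (K := K) (j := k + 1) (m' := F.m) (K' := n) (j' := 0) (by omega)) V)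
    (fieldShift (F.sitesPerDir_eq (m := F.m) (K := K + 1) (j := k + 1 + 1) (m' := F.m) (K' := n) (j' := 0) (by omega)) V)
  -- letters of the budget
  set e : ℝ := Real.exp (-κ₁ * (tsys 3 (nblkOf (SK F 𝔠 γ hγ hγ1 K) 𝔠.lane.carrier k)).dj X) with hedef
  set ρw : ℝ := w n * (((F.L : ℝ) ^ (1 + k))⁻¹) ^ a with hρdef
  set t : ℝ := θBal F.L γ 𝔠.b₀ (𝔠.p₀ + 𝔠.r₀) n ^ 7 with htdef
  have he : 0 ≤ e := (Real.exp_pos _).le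
  have hρw : 0 ≤ ρw := mul_nonneg (hw n) (Real.rpow_nonneg (by positivity) _)
  have hθ0 : 0 ≤ θBal F.L γ 𝔠.b₀ 𝔠.p₀ n := (T3MinimiserStabilityReduction.θBal_pos hL hγ hγ1' 𝔠.b₀_pos 𝔠.p₀ n).le
  have ht : 0 ≤ t := pow_nonneg (T3MinimiserStabilityReduction.θBal_pos hL hγ hγ1' 𝔠.b₀_pos _ n).le 7
  -- the step far terms at the collar profile
  have hpp : 𝔠.p₀ ≤ 𝔠.p₀ + 𝔠.r₀ := by linarith
  have hθ7 : θBal F.L γ 𝔠.b₀ 𝔠.p₀ n ^ 7 ≤ t :=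
    pow_le_pow_left₀ hθ0 (GlobalSlackOn.θBal_mono_p hL hγ hγ1' 𝔠.b₀_pos.le hpp n) 7
  have hf : |((q (K + 1)).𝔖 (k + 1)).far (domCast (nblkOf_succ_eq (hγ := hγ) (hγ1 := hγ1) K k) X) (Hist.triv (F.P (K + 1)) (k + 1 + 1))
          (fieldShift (F.sitesPerDir_eq (m := F.m) (K := K + 1) (j := k + 1 + 1) (m' := F.m) (K' := n) (j' := 0) (by omega)) V) -
        ((q K).𝔖 k).far X (Hist.triv (F.P K) (k + 1))
          (fieldShift (F.sitesPerDir_eq (m := F.m) (K := K) (j := k + 1) (m' := F.m) (K' := n) (j' := 0) (by omega)) V)| ≤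
      2 * (𝔠.Cfar * 𝔠.C25 * logPowConst (7 * 𝔠.r₀) 1) * e * t :=
    hf0.trans (mul_le_mul_of_nonneg_left hθ7 (mul_nonneg (by positivity) he))
  -- regroup with the rows' own atoms
  have hT : ∀ (jΨ jΨ' f f' jΛ jΛ' g g' dJ dΛ : ℝ),
      (jΨ' - f') + (jΛ' - g') - ((jΨ - f) + (jΛ - g)) - (dJ + dΛ) = (jΨ' - jΨ - dJ) + ((jΛ' - g') - (jΛ - g) - dΛ) - (f' - f) := by
    intros; ring
  refine (three_terms_collar (hT _ _ _ _ _ _ _ _ _ _) hj hl hf).trans ?_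
  have h1 : 0 ≤ C_J * e * t := mul_nonneg (mul_nonneg hCJ he) ht
  have h2 : 0 ≤ 2 * (𝔠.Cfar * 𝔠.C25 * logPowConst (7 * 𝔠.r₀) 1) * e * ρw := mul_nonneg (mul_nonneg (by positivity) he) hρw
  nlinarith [h1, h2]

/-! ## §3 The newborn row at the collar profile from the three displayed two-run rows -/

/-- **THE NEWBORN TWO-RUN ROW OF (i*)χ/3⁗χ AT THE COLLAR PROFILE FROM `K1aStepΨRows`, `K1aStepΛRows` AND `CfgCauchyStepOnRows`** (`0 < t ≤ 1`, `κ₁ ≤ 𝔠.κ`, `0 ≤ a`, `√γ ≤ e^{1−(p₀+r₀)}`, the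
configuration window `cB·r(g_k)g_kp(g_k) ≤ 1` along every run, `0 ≤ C_Ψ, C_Λ, C_B`): the step-jet row (p591487, at the collar window, weight raised from `θ_{p₀}²` to `θ_{p₀+r₀}²`), the
Λ-row (p591952, rate lowered from `a` to `a(1−t)`), and §2.  Constant: `5·(cB²·C_Ψ^{1−t}(2C_E)ᵗ·M(2r₀,t) + 6·cB·C_B·C_E·M(2r₀,1)) + (5·(cB²·C_Λ + 6·cB·C_B·C_EΛ) + 2·Cfar·C63) +
2·Cfar·C25·M(7r₀,1)`, `C_E = C25·(max 1 (12/ρ))⁶`, `C_EΛ = C63·(max 1 (12/ρ))⁶`. [cite: King1986, Prop. 3.6 (3.55)-(3.56) p.662, Prop. 3.8 (3.71) p.664, Thm 3.4 (3.9) p.656; Balaban1985UV3, (28) p.263, (33)-(34) p.264, (57) p.270, (59)-(63) pp.270-272] -/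
theorem newTermSlackOnRows_collar_of_k1a_cfgCauchy (S : WinPred F) (q : ∀ K, AlphaInputsT3AC.PkgCoreRows F 𝔠 γ hγ hγ1 K) {κ₁ a C_Ψ C_Λ C_B t : ℝ}
    (hκ₁ : κ₁ ≤ 𝔠.κ) (ha : 0 ≤ a) (ht : 0 < t) (ht1 : t ≤ 1) (hγe : Real.sqrt γ ≤ Real.exp (1 - (𝔠.p₀ + 𝔠.r₀))) (hCΨ : 0 ≤ C_Ψ) (hCΛ : 0 ≤ C_Λ) (hCB : 0 ≤ C_B)
    (hwin : ∀ K k, k + 1 ≤ K →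
      𝔠.cB * (B10.rFun 𝔠.r₀ ((SK F 𝔠 γ hγ hγ1 K).gk k) * (SK F 𝔠 γ hγ hγ1 K).gk k * B10.pFun 𝔠.b₀ 𝔠.p₀ ((SK F 𝔠 γ hγ hγ1 K).gk k)) ≤ 1)
    (hKΨ : K1aStepΨRows q κ₁ a C_Ψ) (hKΛ : K1aStepΛRows q κ₁ a C_Λ) (hB : CfgCauchyStepOnRows S q 𝔠.b₀ (𝔠.p₀ + 𝔠.r₀) a C_B) :
    NewTermSlackOnRows S q 𝔠.b₀ (𝔠.p₀ + 𝔠.r₀) κ₁ (fun n => θBal F.L γ 𝔠.b₀ (𝔠.p₀ + 𝔠.r₀) n ^ 2) (a * (1 - t)) 7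
      (5 * (𝔠.cB ^ 2 * (C_Ψ ^ (1 - t) * (2 * (𝔠.C25 * (max 1 (12 / 𝔠.ρ)) ^ 6)) ^ t * logPowConst (2 * 𝔠.r₀) t) +
          6 * 𝔠.cB * C_B * (𝔠.C25 * (max 1 (12 / 𝔠.ρ)) ^ 6 * logPowConst (2 * 𝔠.r₀) 1)) +
        (5 * (𝔠.cB ^ 2 * C_Λ + 6 * 𝔠.cB * C_B * (𝔠.C63 * (max 1 (12 / 𝔠.ρ)) ^ 6)) + 2 * (𝔠.Cfar * 𝔠.C63)) +
        2 * (𝔠.Cfar * 𝔠.C25 * logPowConst (7 * 𝔠.r₀) 1)) := by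
  have hL : 1 ≤ F.L := F.hL.2.le
  have hγ1' : γ ≤ 1 := hγ1.trans (sq_min_one_le _ 𝔠.gamma0_pos)
  have hr0 : 0 ≤ 𝔠.r₀ := le_trans zero_le_one 𝔠.one_le_r₀
  have hγe₀ : Real.sqrt γ ≤ Real.exp (1 - 𝔠.p₀) := hγe.trans (Real.exp_le_exp.mpr (by linarith))
  have hcB := 𝔠.cB_nonneg
  -- the step-jet row at the collar window, weight raised to the collar profile
  have hJ₀ := jetStepSlackOnRows_of_k1a_cfgCauchy S q (b₀ := 𝔠.b₀) (p₀ := 𝔠.p₀ + 𝔠.r₀) hκ₁ ha ht ht1 hγe₀ hCΨ hCB hwin hKΨ hB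
  have hCJ : 0 ≤ 5 * (𝔠.cB ^ 2 * (C_Ψ ^ (1 - t) * (2 * (𝔠.C25 * (max 1 (12 / 𝔠.ρ)) ^ 6)) ^ t * logPowConst (2 * 𝔠.r₀) t) +
      6 * 𝔠.cB * C_B * (𝔠.C25 * (max 1 (12 / 𝔠.ρ)) ^ 6 * logPowConst (2 * 𝔠.r₀) 1)) := by
    have := 𝔠.C25_nonneg
    have h1 : 0 ≤ logPowConst (2 * 𝔠.r₀) t := (logPowConst_pos (by positivity) ht).le
    have h2 : 0 ≤ logPowConst (2 * 𝔠.r₀) 1 := (logPowConst_pos (by positivity) one_pos).le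
    have h3 : 0 ≤ C_Ψ ^ (1 - t) * (2 * (𝔠.C25 * (max 1 (12 / 𝔠.ρ)) ^ 6)) ^ t :=
      mul_nonneg (Real.rpow_nonneg hCΨ _) (Real.rpow_nonneg (by positivity) _)
    positivity
  have hpp : 𝔠.p₀ ≤ 𝔠.p₀ + 𝔠.r₀ := by linarith
  have hJ := jetStepSlackOnRows_mono_w S q hCJ (fun n => pow_le_pow_left₀
      (T3MinimiserStabilityReduction.θBal_pos hL hγ hγ1' 𝔠.b₀_pos 𝔠.p₀ n).le (GlobalSlackOn.θBal_mono_p hL hγ hγ1' 𝔠.b₀_pos.le hpp n) 2) hJ₀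
  -- the Λ row at the collar profile, rate lowered to `a(1−t)`
  have hΛ₀ := lambdaTermSlackOnRows_of_k1aΛ_cfgCauchy S q hκ₁ hγe hCΛ hCB hwin hKΛ hB
  have hCΛ' : 0 ≤ 5 * (𝔠.cB ^ 2 * C_Λ + 6 * 𝔠.cB * C_B * (𝔠.C63 * (max 1 (12 / 𝔠.ρ)) ^ 6)) + 2 * (𝔠.Cfar * 𝔠.C63) := by
    have := 𝔠.C63_nonneg; have := 𝔠.Cfar_nonneg
    positivity
  have hat : a * (1 - t) ≤ a := by nlinarith
  have hΛ := lambdaTermSlackOnRows_mono_a S q hCΛ' (fun n => sq_nonneg _) hat hΛ₀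
  exact newTermSlackOnRows_of_jetStep_lambda_collar S q hκ₁ hγe₀ (fun n => sq_nonneg _) hCJ hJ hΛ

end Summit.QuantumFields.YangMills.Theorems.GlobalSlackCanonicalPolymers

end
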